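import Mathlib

/-!
# Solo-blind seat (MatrixMultiplication), s68 — the EXTENSION-PROPERTY REDUCTION LEMMA (TRIANGLE.md (R18.15e), CLAIMS c673/c675)

EXTENSION PROPERTY (conjecture EP, exhaustive for rank ≤ 5): every zero-sum-free sequence over `𝔽₃^r` of length
`< 2r` extends by one term to a zero-sum-free sequence (equivalently: no zero-sum-free `S` with `|S| < 2r` has
`Σ(S) = 𝔽₃^r ∖ {0}`); it fails in every group of exponent `≥ 4`.  This file proves the two glueing steps of the
REDUCTION of EP to indecomposable sequences: split the terms of `h` by a subgroup `V` into the inside part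
`w = {i : h i ∈ V}` and the outside part `u = {i : h i ∉ V}`.
* `soloBlind_extend_outside`: if a non-zero class `c` of `G ⧸ V` is such that `-c` is not a non-empty sub-sum of
  `u` read modulo `V`, then EVERY `y` in the class `c` extends `h` (no sub-sum `T ⊆ s` has `y + Σ_T h = 0`).
* `soloBlind_extend_inside`: if `u` is zero-sum free modulo `V` (the decomposability hypothesis) and `v ∈ V`
  extends the inside part `w`, then `v` extends `h`.
So a decomposable short sequence extends as soon as the extension property holds in the two smaller ranks
(`dim V` and `codim V`), and a minimal counterexample to EP is indecomposable.  Pure group theory (any additive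
commutative group); no `ω` content by itself.
-/

set_option linter.dupNamespace false

namespace Summit.MatrixMultiplication.MatrixMultiplication.Theorems

open Finset BigOperators
open scoped Classical

section ExtensionReduction

variable {ι : Type*} {G : Type*} [AddCommGroup G]

/-- OUTSIDE STEP.  If `c ≠ 0` in `G ⧸ V` and no non-empty sub-sum of the terms outside `V` is `≡ -c (mod V)`, then every
`y ≡ c` extends `h`: `y + Σ_{i ∈ T} h i ≠ 0` for all `T ⊆ s`. -/
theorem soloBlind_extend_outside (s : Finset ι) (h : ι → G) (V : AddSubgroup G) (c : G ⧸ V) (hc0 : c ≠ 0)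
    (hc : ∀ T ⊆ s.filter (fun i => h i ∉ V), T.Nonempty →
      QuotientAddGroup.mk' V (∑ i ∈ T, h i) ≠ -c)
    (y : G) (hy : QuotientAddGroup.mk' V y = c) (T : Finset ι) (hT : T ⊆ s) :
    y + ∑ i ∈ T, h i ≠ 0 := by
  intro heq
  -- split T into its outside and inside parts
  set Tu := T.filter (fun i => h i ∉ V) with hTu
  set Tw := T.filter (fun i => h i ∈ V) with hTw
  have hsplit : ∑ i ∈ T, h i = ∑ i ∈ Tu, h i + ∑ i ∈ Tw, h i := by
    rw [hTu, hTw, add_comm, Finset.sum_filter_add_sum_filter_not]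
  have hTwV : ∑ i ∈ Tw, h i ∈ V :=
    V.sum_mem fun i hi => (Finset.mem_filter.mp hi).2
  -- read the equation modulo V
  have hmod : QuotientAddGroup.mk' V (∑ i ∈ Tu, h i) = -c := by
    have h1 : QuotientAddGroup.mk' V (y + ∑ i ∈ T, h i) = 0 := by rw [heq, map_zero]
    have h2 : QuotientAddGroup.mk' V (∑ i ∈ Tw, h i) = 0 := by
      rw [QuotientAddGroup.mk'_apply, QuotientAddGroup.eq_zero_iff]
      exact hTwV
    rw [map_add, hy, hsplit, map_add, h2, add_zero] at h1
    -- h1 : c + mk (Σ_Tu) = 0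
    exact eq_neg_of_add_eq_zero_right h1
  by_cases hne : Tu.Nonempty
  · exact hc Tu (Finset.filter_subset_filter _ hT) hne hmod
  · rw [Finset.not_nonempty_iff_eq_empty] at hne
    rw [hne, Finset.sum_empty, map_zero] at hmod
    exact hc0 (neg_eq_zero.mp hmod.symm)

/-- INSIDE STEP.  If the terms outside `V` are zero-sum free modulo `V` (decomposability along `V`) and `v ∈ V` extends the
inside part (`v + Σ_T h ≠ 0` for `T ⊆ {i ∈ s : h i ∈ V}`), then `v` extends `h`. -/
theorem soloBlind_extend_inside (s : Finset ι) (h : ι → G) (V : AddSubgroup G)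
    (hu : ∀ T ⊆ s.filter (fun i => h i ∉ V), T.Nonempty → (∑ i ∈ T, h i) ∉ V)
    (v : G) (hv : v ∈ V)
    (hw : ∀ T ⊆ s.filter (fun i => h i ∈ V), v + ∑ i ∈ T, h i ≠ 0)
    (T : Finset ι) (hT : T ⊆ s) : v + ∑ i ∈ T, h i ≠ 0 := by
  intro heq
  set Tu := T.filter (fun i => h i ∉ V) with hTu
  set Tw := T.filter (fun i => h i ∈ V) with hTw
  have hsplit : ∑ i ∈ T, h i = ∑ i ∈ Tu, h i + ∑ i ∈ Tw, h i := by
    rw [hTu, hTw, add_comm, Finset.sum_filter_add_sum_filter_not]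
  have hTwV : ∑ i ∈ Tw, h i ∈ V :=
    V.sum_mem fun i hi => (Finset.mem_filter.mp hi).2
  by_cases hne : Tu.Nonempty
  · -- the outside part of T would be a non-empty sub-sum of u landing in V
    apply hu Tu (Finset.filter_subset_filter _ hT) hne
    have : ∑ i ∈ Tu, h i = -(v + ∑ i ∈ Tw, h i) := by
      rw [hsplit] at heq
      -- heq : v + (Σ_Tu + Σ_Tw) = 0
      have := eq_neg_of_add_eq_zero_left
        (show ∑ i ∈ Tu, h i + (v + ∑ i ∈ Tw, h i) = 0 by rw [← heq]; abel)
      exact this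
    rw [this]
    exact V.neg_mem (V.add_mem hv hTwV)
  · -- T lies inside w
    rw [Finset.not_nonempty_iff_eq_empty] at hne
    have hTw' : T ⊆ s.filter (fun i => h i ∈ V) := by
      intro i hi
      rw [Finset.mem_filter]
      refine ⟨hT hi, ?_⟩
      by_contra hiV
      have : i ∈ Tu := Finset.mem_filter.mpr ⟨hi, hiV⟩
      rw [hne] at this
      exact Finset.notMem_empty i this
    exact hw T hTw' heq

end ExtensionReduction

end Summit.MatrixMultiplication.MatrixMultiplication.Theorems
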